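import Literature.NumberTheory.Automorphic.PairLFunctionMeromorphicContinuationNeConjLocalReduction
import Literature.NumberTheory.Automorphic.PairLFunctionNeConjGlobalRankinSelbergTwisted
import HarnessLib

/-!
# Corollaire (i)(b) of Mœglin–Waldspurger reduced to the local Rankin–Selberg theory alone

Topic `NumberTheory/Automorphic`; namespace `Literature.NumberTheory.Automorphic`. Proof file (theorems
only). The reduction `MoeglinWaldspurger1989_partialPairL_entire_of_ne_conj_of_local`
(`PairLFunctionMeromorphicContinuationNeConjLocalReduction`) of the named fact
`MoeglinWaldspurger1989_partialPairL_entire_of_ne_conj` (Mœglin–Waldspurger (1989), Appendice, Cor. (i)(b):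
`L^S(s, π × σ)` is entire for cuspidal `π ≠ σ̄` on `GL_n(𝔸_K)`) had two inputs: the local theory `hloc`
for the pairs `π ≠ σ̄` with a common central action (`ω_π ω_σ = 1`), and — stated as its own conclusion —
`htw`, the case of the pairs without one, which the printed proof treats with the mirabolic Eisenstein
series twisted by `ω_π ω_σ` (Cogdell (2004), §2.3, p. 211). The twisted theory being in the tree now
(`MirabolicEisensteinSeriesTwisted` … `PairLFunctionNeConjGlobalRankinSelbergTwisted`), this file
discharges `htw`: `MoeglinWaldspurger1989_partialPairL_entire_of_ne_conj_of_local'` (**main**) derives the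
fact from the local Rankin–Selberg theory ALONE, asked for every pair `π ≠ σ̄` (hypothesis `hloc`, the
same finitely-many-data statement as before without the central-character proviso: Jacquet–Piatetski-
Shapiro–Shalika (1983), §2, Thm. 2.7; Jacquet–Shalika (1981), §1, §3; at infinity Jacquet–Shalika (1990)).

Proof: `exists_entire_eq_partialPairL_of_not_commonCentral_of_local` proves the statement `htw` from
`hloc`: for a pair `π ≠ σ̄` on which the centre does not act through common scalars, the central characters
`ω = ω_π`, `ω' = ω_{σ̄}` (`exists_centralCharacter_smoothedForm`) differ, `η = ω ω'⁻¹ ≠ 1` is unitary and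
trivial on `A_G`, and the twisted global theorem (`exists_entire_eq_partialPairL_mul_setIntegral_pair_twisted`)
gives entire `F_i` with `F_i = C A_i L^{S₀}` on the strip directly (the twisted Eisenstein series has no
poles); `G = C⁻¹ B ∑ c_i F_i` is entire and equals `L^{S₀}` on the strip, hence on `re s > 1`. The main
theorem is then `…_of_local` with this `htw`.

## References

* C. Mœglin, J.-L. Waldspurger, *Le spectre résiduel de GL(n)*, Ann. Sci. ÉNS 22 (1989), Appendice,
  Corollaire (i)(b), p. 667 [MoeglinWaldspurger1989].
* J. W. Cogdell, *Analytic theory of L-functions for GL_n*, in *An Introduction to the Langlands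
  Program* (2004), §2.3 (p. 211), §3, §4.2 [CogdellAnalyticTheory2004].
* H. Jacquet, J. A. Shalika, *On Euler products and the classification of automorphic
  representations I, II*, Amer. J. Math. 103 (1981), I §4, II Prop. 3.6 [JacquetShalikaAJM1981].
-/

noncomputable section

open MeasureTheory Measure NumberField IsDedekindDomain Matrix Set Filter Topology
open scoped ENNReal NNReal ComplexConjugate

namespace Literature.NumberTheory.Automorphic

open Literature.NumberTheory.GaloisRepresentations (ideleGroup HeckeCharacter)

-- the automorphic quotient carries the tree's Borel σ-algebra, not Mathlib's quotient σ-algebra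
-- (verbatim from `RankinSelbergUnfoldingIdentity`)
attribute [-instance] Quotient.instMeasurableSpace QuotientGroup.measurableSpace

section LocalReductionTwisted

open ValuativeRel

variable {n : ℕ} {K : Type} [Field K] [NumberField K]
variable {μ' : Measure (AdelicGroupData.gl n K).automorphicQuotient} [(AdelicGroupData.gl n K).IsAutomorphicMeasure μ']
variable [MeasurableSpace (AdeleRing (𝓞 K) K)] [BorelSpace (AdeleRing (𝓞 K) K)]

-- the house local instances, exactly as in `RankinSelbergUnfoldingIdentity`
attribute [local instance] adelicBorel borelSpace_adelic locallyCompactSpace_adelic secondCountableTopology_gl_adelic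
  glAdeleBorel borelSpace_glAdele borelSpace_ideleGroup secondCountableTopology_ideleGroup

/-- **The pairs without a common central action, from the local theory** — the input `htw` of
`MoeglinWaldspurger1989_partialPairL_entire_of_ne_conj_of_local`, discharged. Assume `hloc`, the local
Rankin–Selberg theory for every pair `π ≠ σ̄` (the finitely-many-data statement of `…_of_local` without
its central-character proviso). Then for `0 < n`, multiplicity one, cuspidal `π ≠ σ̄` on which the centre
does NOT act through common scalars of modulus one, and Satake families `α`, `β` off a finite `S₀`, the
partial `L`-function `partialPairL S₀ α β` extends from `re s > 1` to an entire function. Proof: the central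
characters `ω = ω_π`, `ω' = ω_{σ̄}` (`exists_centralCharacter_smoothedForm`) differ (else the centre acts
through the common scalars `ω(z)`), so `η = ω ω'⁻¹ ≠ 1` is unitary and trivial on `A_G`; the twisted global
theorem (`exists_entire_eq_partialPairL_mul_setIntegral_pair_twisted`) gives entire `F_i = C A_i L^{S₀}` on
the strip for the data of `hloc` (`partialPairL_eq_prod_mul_partialPairL` moves the unramified factors of
`S'_i ∖ S₀`), and `G = C⁻¹ B ∑ c_i F_i` is entire and equals `L^{S₀}` on the strip, hence on `re s > 1`
(`eq_mul_partialPairL_of_eqOn_strip`). Cogdell (2004), §2.3 p. 211, Thm. 2.2, §4.2; Mœglin–Waldspurger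
(1989), Appendice, Cor. (i)(b).
[cite: MoeglinWaldspurger1989, Appendice, Corollaire (i)(b), p. 667] [cite: CogdellAnalyticTheory2004, §2.3, p. 211] -/
theorem exists_entire_eq_partialPairL_of_not_commonCentral_of_local
    (νI : Measure (ideleGroup K)) [νI.IsHaarMeasure]
    (νA : Measure (Fin n → ideleGroup K)) [IsHaarMeasure νA]
    (νK : Measure ↥(maximalCompactAdelic n K)) [IsHaarMeasure νK]
    (ν₀ : Measure ↥(adelicUnipotent n K)) [IsHaarMeasure ν₀]
    (hloc : ∀ (_hn : 0 < n) (_h₁ : multiplicity_one_gl n K μ')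
      (P P' : CuspidalAutomorphicRepGL n K μ') (_hne : P ≠ P'.conj)
      {S₀ : Set (HeightOneSpectrum (𝓞 K))} (_hS₀ : S₀.Finite) {α β : SatakeFamily K}
      (_hα : IsSatakeFamilyOf P S₀ α) (_hβ : IsSatakeFamilyOf P' S₀ β),
      ∃ (m : ℕ) (c : Fin m → ℂ) (f : Fin m → P.1.toSubmodule) (f' : Fin m → P'.conj.1.toSubmodule)
        (𝔫₀ : Fin m → Ideal (𝓞 K)) (_h𝔫₀ : ∀ i, 𝔫₀ i ≠ 0)
        (η : Fin m → (AdelicGroupData.gl n K).Adelic → ℝ) (_hη : ∀ i, IsTestFunctionGL n K (η i))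
        (_hηK : ∀ i, ∀ k : (AdelicGroupData.gl n K).Adelic, k ∈ principalCongruenceLevel n K (𝔫₀ i) →
          ∀ g : (AdelicGroupData.gl n K).Adelic, η i (k * g) = η i g)
        (S' : Fin m → Set (HeightOneSpectrum (𝓞 K))) (hS'f : ∀ i, (S' i \ S₀).Finite) (_hS₀S' : ∀ i, S₀ ⊆ S' i)
        (_hS' : ∀ i, ∀ v ∉ S' i, ¬ v.asIdeal ∣ 𝔫₀ i ∧ ¬ v.asIdeal ∣ differentIdeal ℤ (𝓞 K))
        (x y : Fin m → HeightOneSpectrum (𝓞 K) → Fin n → ℂ)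
        (_hx : ∀ i, ∀ v ∉ S' i, (Finset.univ : Finset (Fin n)).val.map (x i v) = α v)
        (_hy : ∀ i, ∀ v ∉ S' i, (Finset.univ : Finset (Fin n)).val.map (y i v) = (β v).map conj)
        (Φinf : Fin m → (Fin n → InfiniteAdeleRing K) → ℝ) (_hΦc : ∀ i, Continuous (Φinf i))
        (_hΦ0 : ∀ i, ∀ z, 0 ≤ Φinf i z)
        (_hΦS : ∀ i, (fun v => ((standardTestFun n K (Φinf i) v : ℝ) : ℂ)) ∈ piSchwartzBruhat K (Fin n))
        (B : ℂ → ℂ), Differentiable ℂ B ∧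
          ∀ s : ℂ, 1 < s.re → s.re < 2 →
            B s * (∑ i, c i * ((∏ v ∈ (hS'f i).toFinset,
                (satakePairPolynomial (α v) (β v)).eval ((v.residueCard : ℂ) ^ (-s))) *
              ∫ p in unitBox {v | v ∉ S' i} ×ˢ Set.univ, torusPairIntegrandC n K
                (whittakerCoeff ν₀ (unipotentTateDomain n K) (adeleAddChar K)
                  (invQuot (AdelicGroupData.gl n K) (smoothedForm (η i) ((f i : P.1.toSubmodule) : (AdelicGroupData.gl n K).L2 μ'))))
                (star (whittakerCoeff ν₀ (unipotentTateDomain n K) (adeleAddChar K)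
                  (invQuot (AdelicGroupData.gl n K) (smoothedForm (η i) ((f' i : P'.conj.1.toSubmodule) : (AdelicGroupData.gl n K).L2 μ')))))
                (standardTestFun n K (Φinf i)) s p ∂(νA.prod νK))) = 1)
    (hn : 0 < n) (h₁ : multiplicity_one_gl n K μ')
    (P P' : CuspidalAutomorphicRepGL n K μ') (hne : P ≠ P'.conj)
    (hω : ¬ (∀ z : ideleGroup K, ∃ c : ℂ, ‖c‖ = 1 ∧
      (∀ f : P.1.toSubmodule,
        (AdelicGroupData.gl n K).rightRegular μ' (Matrix.GeneralLinearGroup.scalar (Fin n) z)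
            (f : (AdelicGroupData.gl n K).L2 μ') = c • (f : (AdelicGroupData.gl n K).L2 μ')) ∧
      (∀ f' : P'.conj.1.toSubmodule,
        (AdelicGroupData.gl n K).rightRegular μ' (Matrix.GeneralLinearGroup.scalar (Fin n) z)
            (f' : (AdelicGroupData.gl n K).L2 μ') = c • (f' : (AdelicGroupData.gl n K).L2 μ'))))
    {S₀ : Set (HeightOneSpectrum (𝓞 K))} (hS₀ : S₀.Finite) {α β : SatakeFamily K}
    (hα : IsSatakeFamilyOf P S₀ α) (hβ : IsSatakeFamilyOf P' S₀ β) :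
    ∃ g : ℂ → ℂ, Differentiable ℂ g ∧ ∀ s : ℂ, 1 < s.re → g s = partialPairL S₀ α β s := by
  classical
  -- the central characters of `π` and `σ̄` differ
  obtain ⟨ω, hωu, hωA, hωact, hωS, -, -⟩ := P.exists_centralCharacter_smoothedForm
  obtain ⟨ω', hω'u, hω'A, hω'act, hω'S, -, -⟩ := P'.conj.exists_centralCharacter_smoothedForm
  have hωne : ω ≠ ω' := by
    intro hωeq
    refine hω fun z => ⟨((ω z : ℂˣ) : ℂ), hωu z, fun f => ?_, fun f' => ?_⟩
    · have h := congrArg Subtype.val (hωact z f)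
      rw [ContRepresentation.ClosedSubrep.coe_toContRep_apply, Submodule.coe_smul] at h
      exact h
    · have h := congrArg Subtype.val (hω'act z f')
      rw [ContRepresentation.ClosedSubrep.coe_toContRep_apply, Submodule.coe_smul, ← hωeq] at h
      exact h
  set χ : HeckeCharacter K := ω * ω'⁻¹ with hχ
  have hχ1 : χ ≠ 1 := by
    intro h
    apply hωne
    have h' := congrArg (· * ω') h
    simpa only [hχ, inv_mul_cancel_right, one_mul] using h'
  have hχ₀ : ∀ t : ℝ≥0ˣ, χ (posRealIdele K t) = 1 := fun t => by
    rw [hχ, HeckeCharacter.mul_apply, HeckeCharacter.inv_apply, hωA t, hω'A t, inv_one, mul_one]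
  -- the local data and the twisted global theorem
  obtain ⟨m, c, f, f', 𝔫₀, h𝔫₀, η, hη, hηK, S', hS'f, hS₀S', hS', x, y, hx, hy, Φinf, hΦc, hΦ0, hΦS, B, hB,
    hBsum⟩ := hloc hn h₁ P P' hne hS₀ hα hβ
  obtain ⟨C, hC, hT⟩ :=
    exists_entire_eq_partialPairL_mul_setIntegral_pair_twisted (n := n) (K := K) hn μ' νI νA νK ν₀
  choose F hF hFI hFstrip using fun i : Fin m =>
    hT P P'.conj (f i) (f' i) hωu hω'u hχ hχ1 hχ₀ hα hβ.conj (h𝔫₀ i) (hη i) (hηK i)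
      (fun z g => hωS (η i) (f i) z g) (fun z g => hω'S (η i) (f' i) z g) (hS₀S' i) (hS' i) (hx i) (hy i)
      (hΦc i) (hΦ0 i) (hΦS i)
  -- `∑ c_i F_i = C · L^{S₀} · ∑ c_i A_i` on the strip
  have hββ : (fun v => ((β v).map conj).map conj) = β := funext fun v => multiset_map_conj_map_conj _
  have hmul : ∀ (i : Fin m) (s : ℂ), 1 < s.re → Multipliable fun v : {v : HeightOneSpectrum (𝓞 K) // v ∉ S' i} =>
      ((satakePairPolynomial (α v.1) (β v.1)).eval ((v.1.residueCard : ℂ) ^ (-s)))⁻¹ := fun i s hs =>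
    JacquetShalika1981_multipliable_partialPairL_holds P P' (hα.mono (hS₀S' i)) (hβ.mono (hS₀S' i)) hs
  have hPne : ∀ (i : Fin m) (s : ℂ), 1 < s.re → ∀ v ∈ (hS'f i).toFinset,
      (satakePairPolynomial (α v) (β v)).eval ((v.residueCard : ℂ) ^ (-s)) ≠ 0 := fun i s hs v hv =>
    eval_satakePairPolynomial_ne_zero_of_one_lt_re P P' hα hβ ((hS'f i).mem_toFinset.1 hv).2 hs
  have hsum : ∀ s : ℂ, 1 < s.re → s.re < 2 →
      ∑ i, c i * F i s = ((C : ℂ) * partialPairL S₀ α β s) *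
        ∑ i, c i * ((∏ v ∈ (hS'f i).toFinset,
                (satakePairPolynomial (α v) (β v)).eval ((v.residueCard : ℂ) ^ (-s))) *
              ∫ p in unitBox {v | v ∉ S' i} ×ˢ Set.univ, torusPairIntegrandC n K
                (whittakerCoeff ν₀ (unipotentTateDomain n K) (adeleAddChar K)
                  (invQuot (AdelicGroupData.gl n K) (smoothedForm (η i) ((f i : P.1.toSubmodule) : (AdelicGroupData.gl n K).L2 μ'))))
                (star (whittakerCoeff ν₀ (unipotentTateDomain n K) (adeleAddChar K)
                  (invQuot (AdelicGroupData.gl n K) (smoothedForm (η i) ((f' i : P'.conj.1.toSubmodule) : (AdelicGroupData.gl n K).L2 μ')))))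
                (standardTestFun n K (Φinf i)) s p ∂(νA.prod νK)) := by
    intro s hs1 hs2
    rw [Finset.mul_sum]
    refine Finset.sum_congr rfl fun i _ => ?_
    have h := hFstrip i s hs1 hs2
    beta_reduce at h
    rw [hββ] at h
    have hP0 : (∏ v ∈ (hS'f i).toFinset,
                (satakePairPolynomial (α v) (β v)).eval ((v.residueCard : ℂ) ^ (-s))) ≠ 0 :=
      Finset.prod_ne_zero_iff.2 (hPne i s hs1)
    rw [h, partialPairL_eq_prod_mul_partialPairL (hS₀S' i) (hS'f i) α β (hmul i s hs1), Finset.prod_inv_distrib]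
    field_simp
  -- the entire function `G = C⁻¹ B ∑ c_i F_i`
  set G : ℂ → ℂ := fun s => (C : ℂ)⁻¹ * (B s * ∑ i, c i * F i s) with hGdef
  have hC0 : (C : ℂ) ≠ 0 := Complex.ofReal_ne_zero.2 hC.ne'
  have hsumF : Differentiable ℂ fun s => ∑ i, c i * F i s := by
    have h : Differentiable ℂ (∑ i, fun s => c i * F i s) := Differentiable.sum fun i _ => (hF i).const_mul (c i)
    convert h using 1
    funext s
    simp only [Finset.sum_apply]
  have hG : Differentiable ℂ G := by
    show Differentiable ℂ fun s => (C : ℂ)⁻¹ * (B s * ∑ i, c i * F i s)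
    exact (hB.mul hsumF).const_mul _
  have hGstrip : ∀ s : ℂ, 1 < s.re → s.re < 2 → G s = (fun _ : ℂ => (1 : ℂ)) s * partialPairL S₀ α β s := by
    intro s hs1 hs2
    have h1 := hBsum s hs1 hs2
    show (C : ℂ)⁻¹ * (B s * ∑ i, c i * F i s) = 1 * partialPairL S₀ α β s
    rw [hsum s hs1 hs2, mul_left_comm (B s), h1, mul_one]
    field_simp
  have hGL : ∀ s : ℂ, 1 < s.re → G s = (fun _ : ℂ => (1 : ℂ)) s * partialPairL S₀ α β s :=
    eq_mul_partialPairL_of_eqOn_strip P P' hα hβ hG (differentiable_const _) hGstrip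
  exact ⟨G, hG, fun s hs => by rw [hGL s hs, one_mul]⟩

/-- **Mœglin–Waldspurger (1989), Appendice, Corollaire (i)(b), from the local Rankin–Selberg theory
alone.** Fix Haar measures `ν_I`, `νA`, `νK`, `ν₀`. Assume `hloc` — the local Rankin–Selberg theory for
every pair `π ≠ σ̄` of cuspidal automorphic representations of `GL_n(𝔸_K)`: for every finite `S₀` carrying
Satake families `α`, `β` there are finitely many data of the method — `f_i ∈ π`, `f'_i ∈ σ̄`, levels
`𝔫_i`, test functions `η_i` of level `K(𝔫_i)`, finite `S'_i ⊇ S₀` off which `v ∤ 𝔫_i 𝔡_K`, enumerations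
of `α`, `β̄` off `S'_i`, standard Schwartz–Bruhat `Φ_i = Φ_{i,∞} ⊗ 𝟙` — and coefficients `c_i` such that
`∑_i c_i (∏_{v ∈ S'_i ∖ S₀} det(1 - A_v ⊗ B_v q_v^{-s})) Ψ_{S'_i}(s)` has on `1 < re s < 2` a reciprocal
extending to an ENTIRE `B` (Jacquet–Piatetski-Shapiro–Shalika (1983), §2, Thm. 2.7; Jacquet–Shalika
(1981), §1, §3; `B = ∏_{v ∈ S'} 1/L_v` for data realising the local `L`-factors). Then for `0 < n`,
multiplicity one on `L²_cusp`, cuspidal `π ≠ σ̄` and Satake families `α`, `β` off a finite `S`, the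
partial `L`-function `L^S(s, π × σ) = partialPairL S α β s` (`re s > 1`) extends to an entire function —
the named fact `MoeglinWaldspurger1989_partialPairL_entire_of_ne_conj`: `…_of_local` with its twisted
input `htw` supplied by `exists_entire_eq_partialPairL_of_not_commonCentral_of_local` (the pairs with
`ω_π ≠ ω_{σ̄}` go through the integral against the twisted series `E(g, Φ; s, ω_π ω_{σ̄}⁻¹)`, which is
entire; Cogdell (2004), §2.3 p. 211).
[cite: MoeglinWaldspurger1989, Appendice, Corollaire (i)(b), p. 667] [cite: CogdellAnalyticTheory2004, §4.2 (proof of Thm. 4.2)] -/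
theorem MoeglinWaldspurger1989_partialPairL_entire_of_ne_conj_of_local'
    (νI : Measure (ideleGroup K)) [νI.IsHaarMeasure]
    (νA : Measure (Fin n → ideleGroup K)) [IsHaarMeasure νA]
    (νK : Measure ↥(maximalCompactAdelic n K)) [IsHaarMeasure νK]
    (ν₀ : Measure ↥(adelicUnipotent n K)) [IsHaarMeasure ν₀]
    (hloc : ∀ (_hn : 0 < n) (_h₁ : multiplicity_one_gl n K μ')
      (P P' : CuspidalAutomorphicRepGL n K μ') (_hne : P ≠ P'.conj)
      {S₀ : Set (HeightOneSpectrum (𝓞 K))} (_hS₀ : S₀.Finite) {α β : SatakeFamily K}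
      (_hα : IsSatakeFamilyOf P S₀ α) (_hβ : IsSatakeFamilyOf P' S₀ β),
      ∃ (m : ℕ) (c : Fin m → ℂ) (f : Fin m → P.1.toSubmodule) (f' : Fin m → P'.conj.1.toSubmodule)
        (𝔫₀ : Fin m → Ideal (𝓞 K)) (_h𝔫₀ : ∀ i, 𝔫₀ i ≠ 0)
        (η : Fin m → (AdelicGroupData.gl n K).Adelic → ℝ) (_hη : ∀ i, IsTestFunctionGL n K (η i))
        (_hηK : ∀ i, ∀ k : (AdelicGroupData.gl n K).Adelic, k ∈ principalCongruenceLevel n K (𝔫₀ i) →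
          ∀ g : (AdelicGroupData.gl n K).Adelic, η i (k * g) = η i g)
        (S' : Fin m → Set (HeightOneSpectrum (𝓞 K))) (hS'f : ∀ i, (S' i \ S₀).Finite) (_hS₀S' : ∀ i, S₀ ⊆ S' i)
        (_hS' : ∀ i, ∀ v ∉ S' i, ¬ v.asIdeal ∣ 𝔫₀ i ∧ ¬ v.asIdeal ∣ differentIdeal ℤ (𝓞 K))
        (x y : Fin m → HeightOneSpectrum (𝓞 K) → Fin n → ℂ)
        (_hx : ∀ i, ∀ v ∉ S' i, (Finset.univ : Finset (Fin n)).val.map (x i v) = α v)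
        (_hy : ∀ i, ∀ v ∉ S' i, (Finset.univ : Finset (Fin n)).val.map (y i v) = (β v).map conj)
        (Φinf : Fin m → (Fin n → InfiniteAdeleRing K) → ℝ) (_hΦc : ∀ i, Continuous (Φinf i))
        (_hΦ0 : ∀ i, ∀ z, 0 ≤ Φinf i z)
        (_hΦS : ∀ i, (fun v => ((standardTestFun n K (Φinf i) v : ℝ) : ℂ)) ∈ piSchwartzBruhat K (Fin n))
        (B : ℂ → ℂ), Differentiable ℂ B ∧
          ∀ s : ℂ, 1 < s.re → s.re < 2 →
            B s * (∑ i, c i * ((∏ v ∈ (hS'f i).toFinset,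
                (satakePairPolynomial (α v) (β v)).eval ((v.residueCard : ℂ) ^ (-s))) *
              ∫ p in unitBox {v | v ∉ S' i} ×ˢ Set.univ, torusPairIntegrandC n K
                (whittakerCoeff ν₀ (unipotentTateDomain n K) (adeleAddChar K)
                  (invQuot (AdelicGroupData.gl n K) (smoothedForm (η i) ((f i : P.1.toSubmodule) : (AdelicGroupData.gl n K).L2 μ'))))
                (star (whittakerCoeff ν₀ (unipotentTateDomain n K) (adeleAddChar K)
                  (invQuot (AdelicGroupData.gl n K) (smoothedForm (η i) ((f' i : P'.conj.1.toSubmodule) : (AdelicGroupData.gl n K).L2 μ')))))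
                (standardTestFun n K (Φinf i)) s p ∂(νA.prod νK))) = 1) :
    MoeglinWaldspurger1989_partialPairL_entire_of_ne_conj (n := n) (K := K) (μ := μ') :=
  MoeglinWaldspurger1989_partialPairL_entire_of_ne_conj_of_local νI νA νK ν₀
    (fun hn h₁ P P' hne _ _ hS₀ _ _ hα hβ => hloc hn h₁ P P' hne hS₀ hα hβ)
    (fun hn h₁ P P' hne hω _ hS₀ _ _ hα hβ =>
      exists_entire_eq_partialPairL_of_not_commonCentral_of_local νI νA νK ν₀ hloc hn h₁ P P' hne hω hS₀ hα hβ)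

end LocalReductionTwisted

end Literature.NumberTheory.Automorphic
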